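import Summits.QuantumFields.YangMills.Theorems.BalabanUVNodesN12FlatDatumRigidityNestedPrelim
import Summits.QuantumFields.YangMills.Theorems.BalabanUVNodesN12RootedForest
import HarnessLib

/-!
# BalabanUVNodes ∕ N12 — THE TOWER-SITE CONSTRAINT GRAPH OF `genSet Ω k` IS CONNECTED FOR EVERY NESTED BLOCK-UNION SEQUENCE WITH ONE-BLOCK COLLARS (dag-n12-w1's `T`-closed-set
# currency: the twist obstruction's premise set is EMPTY); dag-n12-w6 g17's `…TowerSiteGraphConnectedBj` §2–§3 re-keyed on the lane's `…N12FlatDatumRigidityNestedPrelim` (N)(B)(S)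

[Balaban1988Convergent] = «[III]», (2.1) p. 254 (admissible sequences: unions of big cubes, `Ω_{j+1} ⊂ Ω_j`), (2.2) p. 255 (the determining set `𝐁 = {Γ_j}`, `Γ₀ = Ω₁ᶜ`,
`Γ_j = Ω_j^{(j)} ∖ Ω_{j+1}^{(j)}`, `Γ_k = Ω_k^{(k)}`), (2.13) pp. 256–257, (2.18) p. 257; [Balaban1985RegularSpaces] = «[6]», (1.3)–(1.6) p. 77 («dist(Ω_n, Ωᶜ_{n−1}) ≥ LⁿξM₁»);
[Balaban1987RG1] (0.1)–(0.3) pp. 251–252 (block lattices, centres); [Balaban1985Variational] = «[15]», Thm 1 p. 279 («a unique critical orbit in the space (6)»), (3)–(4) p. 278.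

Cell `pub-ymgap` (HUMAN RULINGS D-0062 ∕ D-0149), WIDTH SEAT `pub-ymgap-dag-n12-w6` g22 (node N12 = [B15]; key K1⁹ `stmt-QuantumFields-27364`, `--kind proof --supports … --as helper`;
count-neutral).  THEOREMS ONLY (0 `def`, 0 `instance`, 0 `sorry`).  Pure lattice combinatorics BY NAME over: the lane's (dag-n12-c g30) `…N12FlatDatumRigidityNestedPrelim`
(levels for `genSet Ω k` under (N) `Ω (j+1) ⊆ Ω j`, (B) `IsBlockUnion j (Ω j)`, (S) one-block collar «a fine site adjacent to `Ω_{j+1}` has its whole `(j+1)`-block in `Ω_j`»: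
`exists_level_genSet`, `level_unique_genSet`, `levels_near_of_shift_genSet`, `mem_of_level`, `not_mem_succ_of_level`, `mem_genSet_of_blockOf_eq_outerBlock`) and (in the sequel `…TowerSiteGraphConnectedNestedOfRecord`)
`…N12Thm1EUAtFlatDatumAllIndices` §1 ((B)(S) DISCHARGED for the separated cube-class indices), this seat's g17
`…TowerSiteGraphConnectedBjPrelim.blockIter_shift_or`, dag-n12-w3's `N12BlockChains.exists_blockWalk` (a lattice path inside one block) and `N12RootedForest.exists_word_walkEnd_eq`
(the fine torus is connected), dag-n21-e's `blockIter_embIter`.  The piece the lane WORDED to w6 (pub-ymgap INBOX 2026-08-29T20:30:17Z: «WHAT IS GENUINELY LEFT FOR w6 … F2's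
GRAPH-LANGUAGE corollaries … I will NOT type those»).

WHY (numbers, not adjectives).  dag-n12-w1 g4's kernel theorem `N12Thm1CentralLetterTwistObstruction.not_T1central_flat_of_disconnected` (p645205) refutes the tower-CENTRAL
uniqueness clause of [15] Thm 1 at the flat base field from DISCONNECTION DATA `(T, hT, hz₁, hz₂)`: a set `T` of fine sites closed under the constrained bonds of a determining set
`𝔹` (`ι_j c₋ ∈ T ↔ ι_j c₊ ∈ T`) containing one tower site and missing another.  This seat's g17 proved the data cannot be supplied at the record's `𝐁_k(Z) = Bj M₁ Z k`
(`…TowerSiteGraphConnectedBj`, p725507).  The (E∕U) NAME `B11Thm1ExistsUniqueCoP7M(G).VariationalThm1EUSep{Top,CoP}7M(G)` (✓p740853 ∕ ✓p742279) quantifies EVERY separated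
(2.18) index of record `s : Node00.SeqOfRecord F ν M g K k`; dag-n12-c g30's audit (i) (INBOX 2026-08-29T20:07:47Z) asked for «𝒢(s) CONNECTED for EVERY separated index» and
the lane typed the flat-datum RIGIDITY for those indices (`…N12FlatDatumRigidityNested(Prelim)`, `…N12Thm1EUAtFlatDatumAllIndices`).  THIS FILE adds the graph-language
statement itself: §2–§3 for every (N)(B)(S) sequence; the sequel `…TowerSiteGraphConnectedNestedOfRecord` reads it at every separated index of record
(`0 < k ≤ m + K`, `1 ≤ ν.M₁`; (B)(S) from the lane's `…N12Thm1EUAtFlatDatumAllIndices` §1) — the twist obstruction's premise set is EMPTY there.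

THE PROOF (g17's gluing of the levels along `∂Ω_j`, hypotheses abstracted).  Every fine site `x` has a LEVEL `ℓ ≤ k` (the scale whose member `Γ_ℓ` contains the `ℓ`-block of
`x`; lane §1) and a TOWER PROJECTION `τ x := ι_ℓ B^ℓ(x)`, a tower site.  For `T` closed under the constrained bonds the predicate `τ x ∈ T` is invariant along EVERY fine bond
(§2): the two levels differ by at most one ((S)); at equal levels the two `ℓ`-blocks are equal or adjacent, and adjacent `Γ_ℓ`-blocks span a constrained bond; at levels `ℓ`,
`ℓ+1` the `(ℓ+1)`-block `w` of the shallower site is NOT in `Ω_{ℓ+1}` ((B)) but adjacent to the `(ℓ+1)`-block of the deeper one, a `Γ_{ℓ+1}`-site — so `⟨w, ·⟩` is a constrained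
`(ℓ+1)`-bond whose outer tower site `ι_{ℓ+1} w = ι_ℓ (centre of w)` is a level-`ℓ` tower site, and ALL `ℓ`-sites of `w` lie in `Γ_ℓ` ((B)(S), lane's
`mem_genSet_of_blockOf_eq_outerBlock`), so the centre of `w` and `B^ℓ(x)` are joined INSIDE `w` by constrained `ℓ`-bonds (§1, w3's `exists_blockWalk`).  The fine torus is
connected, so `τ x ∈ T` is constant in `x`; a tower site `ι_j c₋` with `c₋ ∈ Γ_j` is its own projection, the other end is `T`-equivalent by closedness — whence §3.

CONTENTS (namespace `Summit.QuantumFields.YangMills.BalabanUVNodes.N12TowerSiteGraphConnectedNested`; generic `P : Params`): §1 ★ `embIter_mem_iff_of_outerBlock`; §2 ★★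
`towerProj_mem_iff_shift_same` ∕ `_up` ∕ `_down` ∕ `towerProj_mem_iff_shift`, `levelPred_iff_shift` ∕ `levelPred_walkEnd` ∕ `levelPred_const`; §3 ★★★ `towerSite_mem_of_closed_genSet`,
★★★ `towerSites_subset_of_closed_genSet`, ★★ `not_disconnected_towerSiteGraph_genSet` (the record instances — every separated (2.18) index — are the sequel's
`towerSite_mem_of_closed_genSet_of_seqSeparated` ∕ `not_disconnected_towerSiteGraph_of_seqSeparated`).

HONEST FRAMING.  A located PRECONDITION (graph connectivity) of the uniqueness clause is discharged for every separated index — NOT [15] Thm 1 (uniqueness at general data is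
[15] Sects. C–G, N07∕NODE 00 mathematics) and NOT a producer of the (E∕U) name; nothing of Bałaban's estimates asserted or refuted; count-neutral helper; N12 NOT discharged;
K0⁷∕K1⁹ NOT closed; counts of record unmoved; one finite 𝕋⁴ programme at fixed ε — R4 closes the conditional rung `BalabanLadder.UV` only; the Yang–Mills mass gap (Clay) is NOT
proved by any of this; nothing continuum ∕ ℝ⁴ ∕ OS.
-/

namespace Summit.QuantumFields.YangMills.BalabanUVNodes.N12TowerSiteGraphConnectedNested

open Set
open Literature.MathematicalPhysics.QuantumFieldTheory.Balaban1983to89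
open B15DeterminingSets (DetSet pts mem_pts bondsOf embIter genSet)
open B14.Eq22Determines (blockIter blockIter_zero blockIter_succ IsBlockUnion)
open T4Continuum (walkEnd)
open Summit.QuantumFields.YangMills.BalabanUVNodes.N12RootedForest (exists_word_walkEnd_eq)
open Summit.QuantumFields.YangMills.BalabanUVNodes.N12BlockChains (exists_blockWalk)
open Summit.QuantumFields.YangMills.Theorems.N21ReadSetSupport (blockIter_embIter)
open Summit.QuantumFields.YangMills.BalabanUVNodes.N12TowerSiteGraphConnectedBjPrelim (blockIter_shift_or)
open Summit.QuantumFields.YangMills.BalabanUVNodes.N12FlatDatumRigidityNestedPrelim (exists_level_genSet level_unique_genSet levels_near_of_shift_genSet mem_of_level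
  not_mem_succ_of_level mem_genSet_of_blockOf_eq_outerBlock)

variable {P : Params} {k : ℕ} {Ω : ℕ → Set (Site P 0)}

/-! ## §1  The `ℓ`-sites of the outer `(ℓ+1)`-block are `T`-equivalent -/

/-- ★ **THE `ℓ`-SITES OF THE OUTER `(ℓ+1)`-BLOCK ARE `T`-EQUIVALENT** for every `T` closed under the constrained bonds of `genSet Ω k`: two `ℓ`-sites `v, v'` of the block `B^{ℓ+1}(x)`
of the lane's `mem_genSet_of_blockOf_eq_outerBlock` ((B)(S)) have `ι_ℓ v ∈ T ↔ ι_ℓ v' ∈ T` — dag-n12-w3's lattice path INSIDE the block (`exists_blockWalk`) runs through `Γ_ℓ`-sites only, so each of its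
bonds is constrained. [cite: Balaban1988Convergent, (2.2) p.255; Balaban1987RG1, (0.3) p.252 (bookkeeping)] -/
theorem embIter_mem_iff_of_outerBlock (hk1 : 1 ≤ k) (hk : k ≤ P.m + P.K) (hBU : ∀ j, 1 ≤ j → j ≤ k → IsBlockUnion j (Ω j))
    (hsep : ∀ j, 1 ≤ j → j + 1 ≤ k → ∀ (x z : Site P 0) (μ : Fin P.d), (z = x.shift μ ∨ x = z.shift μ) → z ∈ Ω (j + 1) →
      ∀ y : Site P 0, blockIter (j + 1) y = blockIter (j + 1) x → y ∈ Ω j)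
    {ℓ : ℕ} (hℓk : ℓ + 1 ≤ k) {x z : Site P 0} {μ : Fin P.d} (hadj : z = x.shift μ ∨ x = z.shift μ)
    (hz : z ∈ Ω (ℓ + 1)) (hx : x ∉ Ω (ℓ + 1)) {T : Set (Site P 0)}
    (hT : ∀ j, j ≤ k → ∀ c ∈ bondsOf (genSet Ω k j), (embIter j c.src ∈ T ↔ embIter j c.tgt ∈ T))
    (v v' : Site P ℓ) (hv : blockOf v = blockIter (ℓ + 1) x) (hv' : blockOf v' = blockIter (ℓ + 1) x) :
    (embIter ℓ v ∈ T ↔ embIter ℓ v' ∈ T) := by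
  -- a level-`ℓ` bond sourced in the block is constrained
  have hbond : ∀ c : PBond P ℓ, blockOf c.src = blockIter (ℓ + 1) x → (embIter ℓ c.src ∈ T ↔ embIter ℓ c.tgt ∈ T) := fun c hc =>
    hT ℓ (by omega) c (Or.inl (mem_genSet_of_blockOf_eq_outerBlock hk1 hk hBU hsep hℓk hadj hz hx hc))
  -- dag-n12-w3's walk inside the block from `v` to `v'`
  obtain ⟨ch, -, hmem, hend, hcons⟩ := exists_blockWalk (show ℓ + 1 ≤ P.m + P.K by omega) _ v v' (hv.trans hv'.symm) rfl
  -- `T`-membership passes along any such walk (induction on the walk, generalising its start)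
  have key : ∀ (ch : List (PBond P ℓ × Bool)) (q : Site P ℓ), (∀ l ∈ ch, blockOf l.1.src = blockIter (ℓ + 1) x) →
      (∀ (pre post : List (PBond P ℓ × Bool)) (l : PBond P ℓ × Bool), ch = pre ++ l :: post →
        (l.2 = true → walkEnd q (pre.map fun l => (l.1.dir, l.2)) = l.1.src) ∧
        (l.2 = false → walkEnd q (pre.map fun l => (l.1.dir, l.2)) = l.1.tgt)) →
      (embIter ℓ q ∈ T ↔ embIter ℓ (walkEnd q (ch.map fun l => (l.1.dir, l.2))) ∈ T) := by
    intro ch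
    induction ch with
    | nil => intro q _ _; exact Iff.rfl
    | cons l₀ ch ih =>
      intro q hblk hread
      obtain ⟨b, s⟩ := l₀
      have h0 := hread [] ch (b, s) rfl
      have hb : embIter ℓ b.src ∈ T ↔ embIter ℓ b.tgt ∈ T := hbond b (hblk (b, s) (List.mem_cons_self))
      -- the tail, read from the site after the first step
      have htail : ∀ q₁ : Site P ℓ, (∀ rest, walkEnd q ((b.dir, s) :: rest) = walkEnd q₁ rest) →
          (embIter ℓ q₁ ∈ T ↔ embIter ℓ (walkEnd q (((b, s) :: ch).map fun l => (l.1.dir, l.2))) ∈ T) := by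
        intro q₁ hq₁
        rw [List.map_cons, hq₁]
        refine ih q₁ (fun l hl => hblk l (List.mem_cons_of_mem _ hl)) (fun pre post l hch => ?_)
        have h := hread ((b, s) :: pre) post l (by rw [hch]; rfl)
        rw [List.map_cons, hq₁] at h
        exact h
      cases s
      · -- backward step: `q = b₊`, next site `b₋`
        have hq : q = b.tgt := h0.2 rfl
        have hnext : ∀ rest, walkEnd q ((b.dir, false) :: rest) = walkEnd b.src rest := fun rest => by
          rw [hq]; show walkEnd ((b.src.shift b.dir).unshift b.dir) rest = _; rw [B10StarCount.unshift_shift]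
        rw [← htail b.src hnext, hq]
        exact hb.symm
      · -- forward step: `q = b₋`, next site `b₊`
        have hq : q = b.src := h0.1 rfl
        have hnext : ∀ rest, walkEnd q ((b.dir, true) :: rest) = walkEnd b.tgt rest := fun rest => by rw [hq]; rfl
        rw [← htail b.tgt hnext, hq]
        exact hb
  have h := key ch v (fun l hl => (hmem l hl).1.trans hv') hcons
  rw [hend] at h
  exact h


/-! ## §2  The tower projection `τ x = ι_ℓ B^ℓ(x)` is `T`-invariant along every fine bond, hence constant on the torus -/

/-- ★★ **SAME LEVEL**: if the `j`-block of `x` is a `Γ_j`-site (`j ≤ k`), then `ι_j B^j(x) ∈ T ↔ ι_j B^j(x + e_μ) ∈ T` — the two blocks are equal, or `μ`-adjacent along the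
constrained bond `⟨B^j(x), μ⟩`. [cite: Balaban1988Convergent, (2.2) p.255; Balaban1987RG1, (0.3) p.252 (bookkeeping)] -/
theorem towerProj_mem_iff_shift_same (hk : k ≤ P.m + P.K) {T : Set (Site P 0)}
    (hT : ∀ j, j ≤ k → ∀ c ∈ bondsOf (genSet Ω k j), (embIter j c.src ∈ T ↔ embIter j c.tgt ∈ T))
    {x : Site P 0} {μ : Fin P.d} {j : ℕ} (hj : j ≤ k) (h : blockIter j x ∈ genSet Ω k j) :
    (embIter j (blockIter j x) ∈ T ↔ embIter j (blockIter j (x.shift μ)) ∈ T) := by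
  rcases blockIter_shift_or (hj.trans hk) x μ with e | e
  · rw [e]
  · rw [e]
    exact hT j hj ⟨blockIter j x, μ⟩ (Or.inl h)

/-- ★★ **ONE LEVEL UP** (`x` of level `j`, `x + e_μ` of level `j + 1 ≤ k`): `ι_j B^j(x) ∈ T ↔ ι_{j+1} B^{j+1}(x + e_μ) ∈ T`.  The `(j+1)`-block `w` of `x` is not that of `x + e_μ`
(`x ∉ Ω_{j+1} ∋ x + e_μ`, a union of `(j+1)`-blocks), so `⟨w, μ⟩` is a constrained `(j+1)`-bond with `ι_{j+1} w = ι_j (centre of w)`, and the centre of `w` is joined to `B^j(x)`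
inside `w` (`embIter_mem_iff_of_outerBlock`). [cite: Balaban1988Convergent, (2.2) p.255, (2.13) pp.256–257] -/
theorem towerProj_mem_iff_shift_up (hk1 : 1 ≤ k) (hk : k ≤ P.m + P.K) (hBU : ∀ j, 1 ≤ j → j ≤ k → IsBlockUnion j (Ω j))
    (hsep : ∀ j, 1 ≤ j → j + 1 ≤ k → ∀ (x z : Site P 0) (μ : Fin P.d), (z = x.shift μ ∨ x = z.shift μ) → z ∈ Ω (j + 1) →
      ∀ y : Site P 0, blockIter (j + 1) y = blockIter (j + 1) x → y ∈ Ω j)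
    {T : Set (Site P 0)} (hT : ∀ j, j ≤ k → ∀ c ∈ bondsOf (genSet Ω k j), (embIter j c.src ∈ T ↔ embIter j c.tgt ∈ T))
    {x : Site P 0} {μ : Fin P.d} {j : ℕ} (hj : j + 1 ≤ k)
    (h : blockIter j x ∈ genSet Ω k j) (h' : blockIter (j + 1) (x.shift μ) ∈ genSet Ω k (j + 1)) :
    (embIter j (blockIter j x) ∈ T ↔ embIter (j + 1) (blockIter (j + 1) (x.shift μ)) ∈ T) := by
  have hx : x ∉ Ω (j + 1) := not_mem_succ_of_level hk hBU (by omega) h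
  have hx' : x.shift μ ∈ Ω (j + 1) := mem_of_level hBU (by omega) hj h'
  rcases blockIter_shift_or (show j + 1 ≤ P.m + P.K by omega) x μ with e | e
  · exfalso
    have hBU1 := hBU (j + 1) (by omega) hj
    have h1 := (hBU1 (x.shift μ)).1 hx'
    rw [e] at h1
    exact hx ((hBU1 x).2 h1)
  · -- the constrained `(j+1)`-bond `⟨w, μ⟩`: its target is the `Γ_{j+1}`-site `B^{j+1}(x + e_μ)`
    have hc : (⟨blockIter (j + 1) x, μ⟩ : PBond P (j + 1)) ∈ bondsOf (genSet Ω k (j + 1)) := by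
      refine Or.inr ?_
      show (blockIter (j + 1) x).shift μ ∈ genSet Ω k (j + 1)
      rw [← e]; exact h'
    have step := hT (j + 1) hj _ hc
    -- inside the block `w`: `B^j(x)` and the centre `emb w` are `T`-equivalent
    have hin := embIter_mem_iff_of_outerBlock hk1 hk hBU hsep hj (Or.inl rfl) hx' hx hT (blockIter j x) (emb (blockIter (j + 1) x))
      (blockIter_succ j x).symm (Site.blockOf_emb (by omega) _)
    rw [hin]
    show embIter (j + 1) (blockIter (j + 1) x) ∈ T ↔ _
    rw [step]
    show embIter (j + 1) ((blockIter (j + 1) x).shift μ) ∈ T ↔ _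
    rw [← e]

/-- ★★ **ONE LEVEL DOWN** (`x` of level `j + 1 ≤ k`, `x + e_μ` of level `j`): `ι_{j+1} B^{j+1}(x) ∈ T ↔ ι_j B^j(x + e_μ) ∈ T` — the mirror image of `towerProj_mem_iff_shift_up`
(the constrained `(j+1)`-bond is now `⟨B^{j+1}(x), μ⟩`, sourced in `Γ_{j+1}`, and the outer block is `B^{j+1}(x + e_μ)`). [cite: Balaban1988Convergent, (2.2) p.255, (2.13) pp.256–257] -/
theorem towerProj_mem_iff_shift_down (hk1 : 1 ≤ k) (hk : k ≤ P.m + P.K) (hBU : ∀ j, 1 ≤ j → j ≤ k → IsBlockUnion j (Ω j))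
    (hsep : ∀ j, 1 ≤ j → j + 1 ≤ k → ∀ (x z : Site P 0) (μ : Fin P.d), (z = x.shift μ ∨ x = z.shift μ) → z ∈ Ω (j + 1) →
      ∀ y : Site P 0, blockIter (j + 1) y = blockIter (j + 1) x → y ∈ Ω j)
    {T : Set (Site P 0)} (hT : ∀ j, j ≤ k → ∀ c ∈ bondsOf (genSet Ω k j), (embIter j c.src ∈ T ↔ embIter j c.tgt ∈ T))
    {x : Site P 0} {μ : Fin P.d} {j : ℕ} (hj : j + 1 ≤ k)
    (h : blockIter (j + 1) x ∈ genSet Ω k (j + 1)) (h' : blockIter j (x.shift μ) ∈ genSet Ω k j) :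
    (embIter (j + 1) (blockIter (j + 1) x) ∈ T ↔ embIter j (blockIter j (x.shift μ)) ∈ T) := by
  have hx : x ∈ Ω (j + 1) := mem_of_level hBU (by omega) hj h
  have hx' : x.shift μ ∉ Ω (j + 1) := not_mem_succ_of_level hk hBU (by omega) h'
  rcases blockIter_shift_or (show j + 1 ≤ P.m + P.K by omega) x μ with e | e
  · exfalso
    have hBU1 := hBU (j + 1) (by omega) hj
    have h1 := (hBU1 x).1 hx
    rw [← e] at h1
    exact hx' ((hBU1 (x.shift μ)).2 h1)
  · -- the constrained `(j+1)`-bond `⟨B^{j+1}(x), μ⟩`, sourced in `Γ_{j+1}`; its target is the outer block `w' = B^{j+1}(x + e_μ)`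
    have hc : (⟨blockIter (j + 1) x, μ⟩ : PBond P (j + 1)) ∈ bondsOf (genSet Ω k (j + 1)) := Or.inl h
    have step := hT (j + 1) hj _ hc
    have hin := embIter_mem_iff_of_outerBlock hk1 hk hBU hsep hj (Or.inr rfl) hx hx' hT (blockIter j (x.shift μ))
      (emb (blockIter (j + 1) (x.shift μ))) (blockIter_succ j (x.shift μ)).symm (Site.blockOf_emb (by omega) _)
    rw [step, hin]
    show (embIter (j + 1) ((blockIter (j + 1) x).shift μ) ∈ T) ↔ embIter (j + 1) (blockIter (j + 1) (x.shift μ)) ∈ T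
    rw [← e]

/-- ★★ **`T`-INVARIANCE OF THE TOWER PROJECTION ALONG A FINE BOND**: for `T` closed under the constrained bonds of `genSet Ω k`, a fine site `x` whose `j`-block is a `Γ_j`-site and its
neighbour `x + e_μ` whose `j'`-block is a `Γ_{j'}`-site (`j, j' ≤ k`): `ι_j B^j(x) ∈ T ↔ ι_{j'} B^{j'}(x + e_μ) ∈ T` (the levels are at most one apart, `levels_near_of_shift`; then
`_same` ∕ `_up` ∕ `_down`). [cite: Balaban1988Convergent, (2.2) p.255, (2.13) pp.256–257] -/
theorem towerProj_mem_iff_shift (hk1 : 1 ≤ k) (hk : k ≤ P.m + P.K) (hnest : ∀ j, 1 ≤ j → j < k → Ω (j + 1) ⊆ Ω j)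
    (hBU : ∀ j, 1 ≤ j → j ≤ k → IsBlockUnion j (Ω j))
    (hsep : ∀ j, 1 ≤ j → j + 1 ≤ k → ∀ (x z : Site P 0) (μ : Fin P.d), (z = x.shift μ ∨ x = z.shift μ) → z ∈ Ω (j + 1) →
      ∀ y : Site P 0, blockIter (j + 1) y = blockIter (j + 1) x → y ∈ Ω j)
    {T : Set (Site P 0)} (hT : ∀ j, j ≤ k → ∀ c ∈ bondsOf (genSet Ω k j), (embIter j c.src ∈ T ↔ embIter j c.tgt ∈ T))
    (x : Site P 0) (μ : Fin P.d) {j j' : ℕ} (hj : j ≤ k) (hj' : j' ≤ k)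
    (h : blockIter j x ∈ genSet Ω k j) (h' : blockIter j' (x.shift μ) ∈ genSet Ω k j') :
    (embIter j (blockIter j x) ∈ T ↔ embIter j' (blockIter j' (x.shift μ)) ∈ T) := by
  obtain ⟨h1, h2⟩ := levels_near_of_shift_genSet hk hnest hBU hsep hj hj' h h'
  rcases lt_trichotomy j j' with hlt | rfl | hgt
  · obtain rfl : j' = j + 1 := by omega
    exact towerProj_mem_iff_shift_up hk1 hk hBU hsep hT hj' h h'
  · exact towerProj_mem_iff_shift_same hk hT hj h
  · obtain rfl : j = j' + 1 := by omega
    exact towerProj_mem_iff_shift_down hk1 hk hBU hsep hT hj h h'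

/-- **THE LEVEL PREDICATE «`ι_j B^j(x) ∈ T` at the level `j` of `x`» IS INVARIANT UNDER `x ↦ x + e_μ`** (levels exist, w3's (Cov), and are unique, §1).
[cite: Balaban1988Convergent, (2.2) p.255, (2.13) pp.256–257] -/
theorem levelPred_iff_shift (hk1 : 1 ≤ k) (hk : k ≤ P.m + P.K) (hnest : ∀ j, 1 ≤ j → j < k → Ω (j + 1) ⊆ Ω j)
    (hBU : ∀ j, 1 ≤ j → j ≤ k → IsBlockUnion j (Ω j))
    (hsep : ∀ j, 1 ≤ j → j + 1 ≤ k → ∀ (x z : Site P 0) (μ : Fin P.d), (z = x.shift μ ∨ x = z.shift μ) → z ∈ Ω (j + 1) →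
      ∀ y : Site P 0, blockIter (j + 1) y = blockIter (j + 1) x → y ∈ Ω j)
    {T : Set (Site P 0)} (hT : ∀ j, j ≤ k → ∀ c ∈ bondsOf (genSet Ω k j), (embIter j c.src ∈ T ↔ embIter j c.tgt ∈ T))
    (x : Site P 0) (μ : Fin P.d) :
    (∀ j, j ≤ k → blockIter j x ∈ genSet Ω k j → embIter j (blockIter j x) ∈ T) ↔
      (∀ j, j ≤ k → blockIter j (x.shift μ) ∈ genSet Ω k j → embIter j (blockIter j (x.shift μ)) ∈ T) := by
  obtain ⟨j₀, hj₀, h₀⟩ := exists_level_genSet hk1 hk hBU x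
  obtain ⟨j₁, hj₁, h₁⟩ := exists_level_genSet hk1 hk hBU (x.shift μ)
  have key := towerProj_mem_iff_shift hk1 hk hnest hBU hsep hT x μ hj₀ hj₁ h₀ h₁
  constructor
  · intro H j hj h
    obtain rfl : j = j₁ := level_unique_genSet hk hnest hBU hj hj₁ h h₁
    exact key.1 (H j₀ hj₀ h₀)
  · intro H j hj h
    obtain rfl : j = j₀ := level_unique_genSet hk hnest hBU hj hj₀ h h₀
    exact key.2 (H j₁ hj₁ h₁)

/-- … hence invariant along every lattice walk (induction on the word; a backward letter is a forward one read from the other end). [cite: Balaban1987RG1, (0.1) p.251 (the torus; bookkeeping)] -/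
theorem levelPred_walkEnd (hk1 : 1 ≤ k) (hk : k ≤ P.m + P.K) (hnest : ∀ j, 1 ≤ j → j < k → Ω (j + 1) ⊆ Ω j)
    (hBU : ∀ j, 1 ≤ j → j ≤ k → IsBlockUnion j (Ω j))
    (hsep : ∀ j, 1 ≤ j → j + 1 ≤ k → ∀ (x z : Site P 0) (μ : Fin P.d), (z = x.shift μ ∨ x = z.shift μ) → z ∈ Ω (j + 1) →
      ∀ y : Site P 0, blockIter (j + 1) y = blockIter (j + 1) x → y ∈ Ω j)
    {T : Set (Site P 0)} (hT : ∀ j, j ≤ k → ∀ c ∈ bondsOf (genSet Ω k j), (embIter j c.src ∈ T ↔ embIter j c.tgt ∈ T)) :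
    ∀ (w : List (Fin P.d × Bool)) (r : Site P 0),
      (∀ j, j ≤ k → blockIter j r ∈ genSet Ω k j → embIter j (blockIter j r) ∈ T) ↔
        (∀ j, j ≤ k → blockIter j (walkEnd r w) ∈ genSet Ω k j → embIter j (blockIter j (walkEnd r w)) ∈ T)
  | [], _ => Iff.rfl
  | (μ, true) :: w, r => (levelPred_iff_shift hk1 hk hnest hBU hsep hT r μ).trans (levelPred_walkEnd hk1 hk hnest hBU hsep hT w (r.shift μ))
  | (μ, false) :: w, r => by
    have h := levelPred_iff_shift hk1 hk hnest hBU hsep hT (r.unshift μ) μ 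
    rw [B10StarCount.shift_unshift] at h
    exact h.symm.trans (levelPred_walkEnd hk1 hk hnest hBU hsep hT w (r.unshift μ))

/-- … hence CONSTANT on the (connected) fine torus (dag-n12-w3's `exists_word_walkEnd_eq`). [cite: Balaban1987RG1, (0.1) p.251 (the torus; bookkeeping)] -/
theorem levelPred_const (hk1 : 1 ≤ k) (hk : k ≤ P.m + P.K) (hnest : ∀ j, 1 ≤ j → j < k → Ω (j + 1) ⊆ Ω j)
    (hBU : ∀ j, 1 ≤ j → j ≤ k → IsBlockUnion j (Ω j))
    (hsep : ∀ j, 1 ≤ j → j + 1 ≤ k → ∀ (x z : Site P 0) (μ : Fin P.d), (z = x.shift μ ∨ x = z.shift μ) → z ∈ Ω (j + 1) →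
      ∀ y : Site P 0, blockIter (j + 1) y = blockIter (j + 1) x → y ∈ Ω j)
    {T : Set (Site P 0)} (hT : ∀ j, j ≤ k → ∀ c ∈ bondsOf (genSet Ω k j), (embIter j c.src ∈ T ↔ embIter j c.tgt ∈ T))
    (x y : Site P 0) :
    (∀ j, j ≤ k → blockIter j x ∈ genSet Ω k j → embIter j (blockIter j x) ∈ T) ↔
      (∀ j, j ≤ k → blockIter j y ∈ genSet Ω k j → embIter j (blockIter j y) ∈ T) := by
  obtain ⟨w, hw⟩ := exists_word_walkEnd_eq x y
  subst hw
  exact levelPred_walkEnd hk1 hk hnest hBU hsep hT w x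

/-! ## §3  Connectivity of the tower-site graph of `genSet Ω k` -/

/-- ★★★ **THE TOWER-SITE CONSTRAINT GRAPH OF `genSet Ω k` IS CONNECTED** (every nested block-union sequence `Ω` with one-block collars, (N)(B)(S); `1 ≤ k ≤ m + K`): a set `T` of fine sites CLOSED under the
constrained bonds of `genSet Ω k` (`ι_j c₋ ∈ T ↔ ι_j c₊ ∈ T` for every `c ∈ bondsOf (genSet Ω k j)`, `j ≤ k`) that contains ONE tower site `ι_{j₁} c₁₋` contains EVERY tower site `ι_{j₂} c₂₋`
— by shape the negation of the disconnection data `(hT, hz₁, hz₂)` of dag-n12-w1's `N12Thm1CentralLetterTwistObstruction.not_T1central_flat_of_disconnected` at `𝔹 := genSet Ω k`: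
the twist obstruction against the uniqueness clause NEVER fires.  Proof: §2's constancy of the level predicate, read at the fine representatives of the `Γ`-ends of
`c₁` and `c₂` (a `Γ_j`-site is its own level-`j` block; the other end is `T`-equivalent by closedness).
[cite: Balaban1988Convergent, (2.2) p.255, (2.13) pp.256–257; Balaban1985Variational, Thm 1 p.279, (3)–(4) p.278] -/
theorem towerSite_mem_of_closed_genSet (hk1 : 1 ≤ k) (hk : k ≤ P.m + P.K) (hnest : ∀ j, 1 ≤ j → j < k → Ω (j + 1) ⊆ Ω j)
    (hBU : ∀ j, 1 ≤ j → j ≤ k → IsBlockUnion j (Ω j))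
    (hsep : ∀ j, 1 ≤ j → j + 1 ≤ k → ∀ (x z : Site P 0) (μ : Fin P.d), (z = x.shift μ ∨ x = z.shift μ) → z ∈ Ω (j + 1) →
      ∀ y : Site P 0, blockIter (j + 1) y = blockIter (j + 1) x → y ∈ Ω j)
    (T : Set (Site P 0)) (hT : ∀ j, j ≤ k → ∀ c ∈ bondsOf (genSet Ω k j), (embIter j c.src ∈ T ↔ embIter j c.tgt ∈ T))
    {j₁ : ℕ} (hj₁ : j₁ ≤ k) {c₁ : PBond P j₁} (hc₁ : c₁ ∈ bondsOf (genSet Ω k j₁)) (hz₁ : embIter j₁ c₁.src ∈ T)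
    {j₂ : ℕ} (hj₂ : j₂ ≤ k) {c₂ : PBond P j₂} (hc₂ : c₂ ∈ bondsOf (genSet Ω k j₂)) : embIter j₂ c₂.src ∈ T := by
  -- at the representative of a `Γ_j`-SITE `s` the level predicate reads `ι_j s ∈ T`
  have hrep : ∀ {j : ℕ}, j ≤ k → ∀ {s : Site P j}, s ∈ genSet Ω k j →
      ((∀ i, i ≤ k → blockIter i (embIter j s) ∈ genSet Ω k i → embIter i (blockIter i (embIter j s)) ∈ T) ↔ embIter j s ∈ T) := by
    intro j hj s hs
    have hb : blockIter j (embIter j s) = s := blockIter_embIter (hj.trans hk) s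
    have hsj : blockIter j (embIter j s) ∈ genSet Ω k j := by rw [hb]; exact hs
    constructor
    · intro H
      have h := H j hj hsj
      rwa [hb] at h
    · intro hsT i hi hi'
      obtain rfl : i = j := level_unique_genSet hk hnest hBU hi hj hi' hsj
      rw [hb]; exact hsT
  -- `c₁` has an end in `Γ_{j₁}` whose representative lies in `T`
  obtain ⟨s₁, hs₁, hs₁T⟩ : ∃ s₁ : Site P j₁, s₁ ∈ genSet Ω k j₁ ∧ embIter j₁ s₁ ∈ T := by
    rcases (show c₁.src ∈ genSet Ω k j₁ ∨ c₁.tgt ∈ genSet Ω k j₁ from hc₁) with h | h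
    · exact ⟨c₁.src, h, hz₁⟩
    · exact ⟨c₁.tgt, h, (hT j₁ hj₁ c₁ hc₁).1 hz₁⟩
  have P1 := (hrep hj₁ hs₁).2 hs₁T
  rcases (show c₂.src ∈ genSet Ω k j₂ ∨ c₂.tgt ∈ genSet Ω k j₂ from hc₂) with h | h
  · exact (hrep hj₂ h).1 ((levelPred_const hk1 hk hnest hBU hsep hT (embIter j₁ s₁) (embIter j₂ c₂.src)).1 P1)
  · exact (hT j₂ hj₂ c₂ hc₂).2 ((hrep hj₂ h).1 ((levelPred_const hk1 hk hnest hBU hsep hT (embIter j₁ s₁) (embIter j₂ c₂.tgt)).1 P1))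

/-- ★★★ **ALL TOWER SITES, BOTH ENDS**: under the hypotheses of `towerSite_mem_of_closed_genSet`, `T` contains `ι_j c₋` and `ι_j c₊` for every constrained bond `c` of every level `j ≤ k`.
[cite: Balaban1988Convergent, (2.2) p.255, (2.13) pp.256–257; Balaban1985Variational, Thm 1 p.279] -/
theorem towerSites_subset_of_closed_genSet (hk1 : 1 ≤ k) (hk : k ≤ P.m + P.K) (hnest : ∀ j, 1 ≤ j → j < k → Ω (j + 1) ⊆ Ω j)
    (hBU : ∀ j, 1 ≤ j → j ≤ k → IsBlockUnion j (Ω j))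
    (hsep : ∀ j, 1 ≤ j → j + 1 ≤ k → ∀ (x z : Site P 0) (μ : Fin P.d), (z = x.shift μ ∨ x = z.shift μ) → z ∈ Ω (j + 1) →
      ∀ y : Site P 0, blockIter (j + 1) y = blockIter (j + 1) x → y ∈ Ω j)
    (T : Set (Site P 0)) (hT : ∀ j, j ≤ k → ∀ c ∈ bondsOf (genSet Ω k j), (embIter j c.src ∈ T ↔ embIter j c.tgt ∈ T))
    {j₁ : ℕ} (hj₁ : j₁ ≤ k) {c₁ : PBond P j₁} (hc₁ : c₁ ∈ bondsOf (genSet Ω k j₁)) (hz₁ : embIter j₁ c₁.src ∈ T) :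
    ∀ j, j ≤ k → ∀ c ∈ bondsOf (genSet Ω k j), embIter j c.src ∈ T ∧ embIter j c.tgt ∈ T := fun j hj c hc =>
  have h := towerSite_mem_of_closed_genSet hk1 hk hnest hBU hsep T hT hj₁ hc₁ hz₁ hj hc
  ⟨h, (hT j hj c hc).1 h⟩

/-- ★★ **THE TWIST OBSTRUCTION's PREMISE SET IS EMPTY FOR EVERY NESTED BLOCK-UNION SEQUENCE WITH ONE-BLOCK COLLARS**: there is NO set of fine sites closed under the constrained bonds of `genSet Ω k` separating two tower sites — the
disconnection data `(T, hT, j₁, c₁, hz₁, j₂, c₂, hz₂)` of `N12Thm1CentralLetterTwistObstruction.not_T1central_flat_of_disconnected` cannot be supplied at `𝔹 := genSet Ω k`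
(`1 ≤ k ≤ m + K`, (N)(B)(S)). [cite: Balaban1988Convergent, (2.2) p.255, (2.1) p.254, p.256; Balaban1985Variational, Thm 1 p.279, (3)–(4) p.278] -/
theorem not_disconnected_towerSiteGraph_genSet (hk1 : 1 ≤ k) (hk : k ≤ P.m + P.K) (hnest : ∀ j, 1 ≤ j → j < k → Ω (j + 1) ⊆ Ω j)
    (hBU : ∀ j, 1 ≤ j → j ≤ k → IsBlockUnion j (Ω j))
    (hsep : ∀ j, 1 ≤ j → j + 1 ≤ k → ∀ (x z : Site P 0) (μ : Fin P.d), (z = x.shift μ ∨ x = z.shift μ) → z ∈ Ω (j + 1) →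
      ∀ y : Site P 0, blockIter (j + 1) y = blockIter (j + 1) x → y ∈ Ω j) :
    ¬ ∃ (T : Set (Site P 0)) (j₁ : ℕ) (c₁ : PBond P j₁) (j₂ : ℕ) (c₂ : PBond P j₂),
        (∀ j, j ≤ k → ∀ c ∈ bondsOf (genSet Ω k j), (embIter j c.src ∈ T ↔ embIter j c.tgt ∈ T)) ∧
        j₁ ≤ k ∧ c₁ ∈ bondsOf (genSet Ω k j₁) ∧ embIter j₁ c₁.src ∈ T ∧
        j₂ ≤ k ∧ c₂ ∈ bondsOf (genSet Ω k j₂) ∧ embIter j₂ c₂.src ∉ T := by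
  rintro ⟨T, j₁, c₁, j₂, c₂, hT, hj₁, hc₁, hz₁, hj₂, hc₂, hz₂⟩
  exact hz₂ (towerSite_mem_of_closed_genSet hk1 hk hnest hBU hsep T hT hj₁ hc₁ hz₁ hj₂ hc₂)


end Summit.QuantumFields.YangMills.BalabanUVNodes.N12TowerSiteGraphConnectedNested
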